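import Summits.BirchSwinnertonDyer.BirchSwinnertonDyer.Theorems.ByReductionTypeAtTwoAdditivePotMultConjATwoAdmissibleCarriers
import Summits.BirchSwinnertonDyer.BirchSwinnertonDyer.Theorems.ByReductionTypeAtTwoOrdKatoHalfAtTwoIsoPosDiscEpsilonDefs
import HarnessLib

/-!
# Cert49s1q — crux-triage r1 seat 1, GEN 49, finding F-49e: the `Y`-half Q⁺ = `FineSelmerConjATwoOrdPosDisc` of G11⁺ on crux 202's
# `0 < Δ` onto cell ⟸ «at each habitat curve, for a root `β` of the `2`-division cubic, SOME admissible `x` with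
# `x² ∈ {−1, −2, −Δ, −2Δ}` has Iwasawa `μ₂ = 0` along the cyclotomic `ℤ₂`-extensions of the totally complex sextic `ℚ(β, x)`» —
# BY NAME of k4-w3 GEN 10's MODEL-GENERIC carrier doors (p737622 `…ConjATwoTorsionPointFieldDoor` §2, p737866
# `…ConjATwoAdmissibleCarriers` §3; filed for C4″ 22618 but stated for every `W/ℚ`).  FOUR CM-sextic carriers per curve instead of ONE
# (v24's displayed door `conjA_two_posDisc_of_classicalMu_pointField` = the case `x² = −1`, w2 p718233).  Per-class certificates only
# (Fukuda pairs of the carrier's first layers; eng-2 GREENBERG2 computed the `x² = −1` carrier: rank-`0` cell cert 62 · grh 217 · open 167 of 446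
# through layer 2; the other three carriers are UNCOMPUTED on this cell).  A DISPLAYED DOOR for the LEAD / w2 — zero verdict input; the `∀` over
# the cell is OPEN; nothing asserted; BSD is not proved by any of this.
-/

set_option autoImplicit false
set_option linter.dupNamespace false

noncomputable section

open scoped Classical NumberField Polynomial IntermediateField
open WeierstrassCurve NumberField IsDedekindDomain Field Polynomial IntermediateField
open Literature.NumberTheory.EllipticCurves Literature.NumberTheory.EllipticCurves.GreenbergSelmer
  Literature.NumberTheory.EllipticCurves.ZpExtension Literature.NumberTheory.GaloisRepresentations Literature.NumberTheory.IwasawaTheory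
  Literature.NumberTheory.EllipticCurves.Rank1Residual
open Summit.BirchSwinnertonDyer.BirchSwinnertonDyer.Theorems.AddKatoTwo
open Summit.BirchSwinnertonDyer.BirchSwinnertonDyer.Theorems.SteinbergFibreAtTwo

namespace Summit.BirchSwinnertonDyer.BirchSwinnertonDyer.Cruxes.OrdKatoHalfAtTwoIso.TriageCert49s1

/-- **F-49e. Q⁺ from «`μ₂ = 0` for SOME admissible CM-sextic carrier at each habitat curve»** — four carriers `ℚ(β, x)`,
`x² ∈ {−1, −2, −Δ(W), −2Δ(W)}`, by name of k4-w3's doors `conjA_two_of_classicalMu_cubicField_adjoin_I` / `…_sqrt_neg_two` / `…_sqrt_neg_Δ` /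
`…_sqrt_neg_two_mul_Δ`.  The hypothesis is an OPEN Iwasawa statement per field; CONDITIONAL; nothing asserted.
[cite: CoatesSujatha2005, Conj. A and Thm. 3.4] [cite: Lim2017FineSelmer, §3 Thm. 3.5 and Lemma 3.2] [cite: Washington1997, §13.1] -/
theorem fineSelmerConjATwoOrdPosDisc_of_exists_admissibleCarrierMu
    (hμx : ∀ (W : WeierstrassCurve ℚ) [W.IsElliptic] [W.IsGloballyMinimal], ¬ W.HasCM → W.analyticRank = 0 →
      GoodOrd W 2 → W.HasSurjectiveModNGaloisRep 2 → 0 < W.Δ →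
      ∀ β : AlgebraicClosure ℚ, aeval β W.twoTorsionPolynomial.toPoly = 0 →
      ∃ x : AlgebraicClosure ℚ, (x ^ 2 = -1 ∨ x ^ 2 = -2 ∨ x ^ 2 = -algebraMap ℚ (AlgebraicClosure ℚ) W.Δ ∨
          x ^ 2 = -2 * algebraMap ℚ (AlgebraicClosure ℚ) W.Δ) ∧
        ∀ κF : ZpExtension ↥(IntermediateField.adjoin ℚ ({β} : Set (AlgebraicClosure ℚ)) ⊔
            IntermediateField.adjoin ℚ ({x} : Set (AlgebraicClosure ℚ))) 2, κF.IsCyclotomic → ClassicalMuVanishes κF) :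
    FineSelmerConjATwoOrdPosDisc := by
  intro W _ _ hcm hr hgo h2 hΔ κ hκ
  obtain ⟨β, hβ⟩ := exists_aeval_twoTorsionPolynomial_eq_zero W
  obtain ⟨x, hx, hμ⟩ := hμx W hcm hr hgo h2 hΔ β hβ
  rcases hx with hx | hx | hx | hx
  · exact conjA_two_of_classicalMu_cubicField_adjoin_I W hβ hx hμ κ hκ
  · exact conjA_two_of_classicalMu_cubicField_adjoin_sqrt_neg_two W hβ hx hμ κ hκ
  · exact conjA_two_of_classicalMu_cubicField_adjoin_sqrt_neg_Δ W hΔ hβ hx hμ κ hκ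
  · exact conjA_two_of_classicalMu_cubicField_adjoin_sqrt_neg_two_mul_Δ W hΔ hβ hx hμ κ hκ

/-- In particular the v24 displayed one-carrier door (`x² = −1`, w2 p718233 / the Lines file's `conjA_two_posDisc_of_classicalMu_pointField`)
is the first disjunct: Q⁺ ⟸ «`μ₂ = 0` of `ℚ(β, i)` at each habitat curve». CONDITIONAL; nothing asserted. [cite: CoatesSujatha2005, Conj. A] -/
theorem fineSelmerConjATwoOrdPosDisc_of_cubicField_adjoin_I_mu
    (hμ : ∀ (W : WeierstrassCurve ℚ) [W.IsElliptic] [W.IsGloballyMinimal], ¬ W.HasCM → W.analyticRank = 0 →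
      GoodOrd W 2 → W.HasSurjectiveModNGaloisRep 2 → 0 < W.Δ →
      ∀ β : AlgebraicClosure ℚ, aeval β W.twoTorsionPolynomial.toPoly = 0 →
      ∃ i : AlgebraicClosure ℚ, i ^ 2 = -1 ∧
        ∀ κF : ZpExtension ↥(IntermediateField.adjoin ℚ ({β} : Set (AlgebraicClosure ℚ)) ⊔
            IntermediateField.adjoin ℚ ({i} : Set (AlgebraicClosure ℚ))) 2, κF.IsCyclotomic → ClassicalMuVanishes κF) :
    FineSelmerConjATwoOrdPosDisc :=
  fineSelmerConjATwoOrdPosDisc_of_exists_admissibleCarrierMu fun W _ _ hcm hr hgo h2 hΔ β hβ =>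
    let ⟨i, hi, hμi⟩ := hμ W hcm hr hgo h2 hΔ β hβ
    ⟨i, Or.inl hi, hμi⟩

end Summit.BirchSwinnertonDyer.BirchSwinnertonDyer.Cruxes.OrdKatoHalfAtTwoIso.TriageCert49s1

end
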